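import Summits.Ventures.PercRepro.C025ProfileFourRule
import Summits.Ventures.PercRepro.C025ProfileGenGeom
/-!
# THE ROW (2,4) OF THE PROFILE INEQUALITY — the exact-demand rule E (night-3 g9)
NIGHT3-G9-TWO-FOUR-CERTIFICATE.md §6. For a rank-`2` set `B` let `F_B := E ∖ cl B` (the non-loops of `M／B`); a pair
`Y ⊆ F_B` is independent in `M／B` when `ρ(B ∪ Y) = 4` (`Gfam`), parallel when `ρ(B ∪ Y) = 3`; `Pfam` are the triples
`Y ∪ {z} ⊆ F_B` with `Y` parallel and `ρ(B ∪ Y ∪ {z}) = 4`; `Lfam` are the triples `{u} ∪ Y` with `u` on the line of `B`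
outside `B` and `Y ∈ Gfam`. **Rule E**: a PAIR `B` pays `1/6` to each `B ∪ Y`, `Y ∈ Gfam`, and spreads its deficit
`(price − |Gfam|/6)⁺` uniformly over `Lfam` (if the line of `B` has a third point) or over `Pfam` (otherwise); a FAT `B`
(`|B| ≥ 3`) spreads its whole price uniformly over `Gfam ∪ Pfam`. No constant is fitted: `(Dem)` holds by construction
(`dem_wE`), and the row `(2,4)` reduces to `(Cap)` of this rule (`CapE`).
-/
open scoped Matroid
namespace PercRepro
open Set Finset ThmH
section FourRuleE
variable {α : Type} [DecidableEq α] (M : Matroid α) [M.Finite]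

/-- `F_B = E ∖ cl B`: the non-loops of `M／B`. -/
noncomputable def Fs (B : Finset α) : Finset α := gr M \ clF M B

open scoped Classical in
/-- `G_B`: the pairs of `F_B` that are independent in `M／B`. -/
noncomputable def Gfam (B : Finset α) : Finset (Finset α) :=
  ((Fs M B).powersetCard 2).filter (fun Y => M.eRk ((B ∪ Y : Finset α) : Set α) = 4)

open scoped Classical in
/-- `P_B`: the triples `Z ⊆ F_B` with `ρ(B ∪ Z) = 4` containing a parallel pair of `M／B`. -/
noncomputable def Pfam (B : Finset α) : Finset (Finset α) :=
  ((Fs M B).powersetCard 3).filter (fun Z => M.eRk ((B ∪ Z : Finset α) : Set α) = 4 ∧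
    ∃ Y ⊆ Z, Y.card = 2 ∧ M.eRk ((B ∪ Y : Finset α) : Set α) = 3)

open scoped Classical in
/-- `Ls_B`: `{u} ∪ Y` with `u` a point of the line of `B` outside `B` and `Y ∈ G_B`. -/
noncomputable def Lfam (B : Finset α) : Finset (Finset α) :=
  ((clF M B \ B) ×ˢ Gfam M B).image (fun uY => insert uY.1 uY.2)

/-- The deficit of a pair `B`: its price minus the `1/6`-shares of its `G`-sets, floored at `0`. -/
noncomputable def defic (B : Finset α) : ℚ :=
  max 0 (Profile.price M 2 4 B - ((Gfam M B).card : ℚ) / 6)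

open scoped Classical in
/-- **Rule E** (NIGHT3-G9-TWO-FOUR-CERTIFICATE.md §6), capacity-`1` normalisation. -/
noncomputable def wE (B S : Finset α) : ℚ :=
  if crk M B < 4 then 0
  else if B.card = 2 then
    (if S \ B ∈ Gfam M B then 1 / 6 else 0) +
    (if 1 ≤ (clF M B \ B).card then
      (if S \ B ∈ Lfam M B then defic M B / ((Lfam M B).card : ℚ) else 0)
     else (if S \ B ∈ Pfam M B then defic M B / ((Pfam M B).card : ℚ) else 0))
  else if S \ B ∈ Gfam M B ∪ Pfam M B then
    Profile.price M 2 4 B / ((Gfam M B ∪ Pfam M B).card : ℚ)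
  else 0

variable {M}

/-- The price of the row `(2,4)` is non-negative. -/
theorem price_nonneg' (B : Finset α) : 0 ≤ Profile.price M 2 4 B := by
  rw [price_two_four_eq]
  split_ifs with h
  · have : (4 : ℚ) ≤ (crk M B : ℚ) := by exact_mod_cast h
    have h1 : (0 : ℚ) ≤ (crk M B : ℚ) - 1 := by linarith
    positivity
  · exact le_rfl

/-- The deficit is non-negative. -/
theorem defic_nonneg (B : Finset α) : 0 ≤ defic M B := le_max_left _ _

/-- Rule E is non-negative. -/
theorem wE_nonneg (B S : Finset α) : 0 ≤ wE M B S := by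
  unfold wE
  have hp := price_nonneg' (M := M) B
  have hd := defic_nonneg (M := M) B
  split_ifs <;> first | exact le_rfl | positivity

/-- Membership in `F_B`. -/
theorem mem_Fs {B : Finset α} {x : α} : x ∈ Fs M B ↔ x ∈ gr M ∧ x ∉ clF M B := Finset.mem_sdiff

/-- `F_B` lies in the ground set. -/
theorem Fs_subset_gr (B : Finset α) : Fs M B ⊆ gr M := Finset.sdiff_subset

/-- A subset of `F_B` is disjoint from `B`. -/
theorem disjoint_of_subset_Fs {B Z : Finset α} (hBg : B ⊆ gr M) (hZ : Z ⊆ Fs M B) : Disjoint B Z := by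
  rw [Finset.disjoint_left]
  intro x hxB hxZ
  exact (mem_Fs.1 (hZ hxZ)).2 (subset_clF_self hBg hxB)

/-- Membership in `G_B`. -/
theorem mem_Gfam {B Y : Finset α} :
    Y ∈ Gfam M B ↔ Y ⊆ Fs M B ∧ Y.card = 2 ∧ M.eRk ((B ∪ Y : Finset α) : Set α) = 4 := by
  unfold Gfam
  rw [Finset.mem_filter, Finset.mem_powersetCard]
  tauto

/-- Membership in `P_B`. -/
theorem mem_Pfam {B Z : Finset α} :
    Z ∈ Pfam M B ↔ Z ⊆ Fs M B ∧ Z.card = 3 ∧ M.eRk ((B ∪ Z : Finset α) : Set α) = 4 ∧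
      ∃ Y ⊆ Z, Y.card = 2 ∧ M.eRk ((B ∪ Y : Finset α) : Set α) = 3 := by
  unfold Pfam
  rw [Finset.mem_filter, Finset.mem_powersetCard]
  tauto

/-- Membership in `Ls_B`. -/
theorem mem_Lfam {B Z : Finset α} :
    Z ∈ Lfam M B ↔ ∃ u ∈ clF M B \ B, ∃ Y ∈ Gfam M B, insert u Y = Z := by
  unfold Lfam
  rw [Finset.mem_image]
  constructor
  · rintro ⟨⟨u, Y⟩, huY, rfl⟩
    rw [Finset.mem_product] at huY
    exact ⟨u, huY.1, Y, huY.2, rfl⟩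
  · rintro ⟨u, hu, Y, hY, rfl⟩
    exact ⟨⟨u, Y⟩, Finset.mem_product.2 ⟨hu, hY⟩, rfl⟩

/-- The sets of the three families are disjoint from `B` and `B ∪ Z` is a rank-`4` subset of the ground set. -/
theorem disjoint_and_level_of_mem_Gfam {B Z : Finset α} (hBg : B ⊆ gr M) (hZ : Z ∈ Gfam M B) :
    Disjoint B Z ∧ B ∪ Z ∈ Shadow.levelSet M 4 := by
  rw [mem_Gfam] at hZ
  refine ⟨disjoint_of_subset_Fs hBg hZ.1, Profile.mem_levelSet.2 ⟨?_, hZ.2.2⟩⟩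
  exact Finset.union_subset hBg (hZ.1.trans (Fs_subset_gr B))

/-- A set of `P_B` is disjoint from `B` and `B ∪ Z` is a rank-`4` subset of the ground set. -/
theorem disjoint_and_level_of_mem_Pfam {B Z : Finset α} (hBg : B ⊆ gr M) (hZ : Z ∈ Pfam M B) :
    Disjoint B Z ∧ B ∪ Z ∈ Shadow.levelSet M 4 := by
  rw [mem_Pfam] at hZ
  refine ⟨disjoint_of_subset_Fs hBg hZ.1, Profile.mem_levelSet.2 ⟨?_, hZ.2.2.1⟩⟩
  exact Finset.union_subset hBg (hZ.1.trans (Fs_subset_gr B))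

/-- A set of `Ls_B` is disjoint from `B` and `B ∪ Z` is a rank-`4` subset of the ground set (the point of the line
of `B` lies in `cl (B ∪ Y)`). -/
theorem disjoint_and_level_of_mem_Lfam {B Z : Finset α} (hBg : B ⊆ gr M) (hZ : Z ∈ Lfam M B) :
    Disjoint B Z ∧ B ∪ Z ∈ Shadow.levelSet M 4 := by
  obtain ⟨u, hu, Y, hY, rfl⟩ := mem_Lfam.1 hZ
  have hYm := mem_Gfam.1 hY
  rw [Finset.mem_sdiff] at hu
  have hdisj : Disjoint B (insert u Y) := by
    rw [Finset.disjoint_insert_right]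
    exact ⟨hu.2, disjoint_of_subset_Fs hBg hYm.1⟩
  refine ⟨hdisj, Profile.mem_levelSet.2 ⟨?_, ?_⟩⟩
  · exact Finset.union_subset hBg (Finset.insert_subset (clF_subset_gr B hu.1) (hYm.1.trans (Fs_subset_gr B)))
  · -- `u ∈ cl B ⊆ cl (B ∪ Y)`, so inserting it does not change the rank
    have hucl : u ∈ M.closure ((B ∪ Y : Finset α) : Set α) := by
      have h1 : u ∈ M.closure (B : Set α) := by rw [← coe_clF]; exact_mod_cast hu.1
      exact M.closure_subset_closure (by rw [Finset.coe_union]; exact Set.subset_union_left) h1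
    have hBYg : ((B ∪ Y : Finset α) : Set α) ⊆ M.E := by
      rw [← coe_gr]; exact_mod_cast Finset.union_subset hBg (hYm.1.trans (Fs_subset_gr B))
    have hle : M.eRk ((B ∪ insert u Y : Finset α) : Set α) ≤ M.eRk ((B ∪ Y : Finset α) : Set α) := by
      rw [← M.eRk_closure_eq ((B ∪ Y : Finset α) : Set α)]
      apply M.eRk_mono
      intro x hx
      rw [Finset.mem_coe, Finset.mem_union, Finset.mem_insert] at hx
      rcases hx with hx | rfl | hx
      · exact M.subset_closure _ hBYg (by rw [Finset.mem_coe, Finset.mem_union]; exact Or.inl hx)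
      · exact hucl
      · exact M.subset_closure _ hBYg (by rw [Finset.mem_coe, Finset.mem_union]; exact Or.inr hx)
    have hge : M.eRk ((B ∪ Y : Finset α) : Set α) ≤ M.eRk ((B ∪ insert u Y : Finset α) : Set α) := by
      apply M.eRk_mono
      intro x hx
      rw [Finset.mem_coe, Finset.mem_union] at hx ⊢
      rcases hx with hx | hx
      · exact Or.inl hx
      · exact Or.inr (Finset.mem_insert_of_mem hx)
    exact le_antisymm hle (hYm.2.2 ▸ hge) |>.trans hYm.2.2

/-- `(B ∪ Z) ∖ B = Z` for `Z` disjoint from `B`. -/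
theorem union_sdiff_self_eq {B Z : Finset α} (h : Disjoint B Z) : (B ∪ Z) \ B = Z := by
  rw [Finset.union_sdiff_left, Finset.sdiff_eq_self_of_disjoint h.symm]

/-- The sum of a non-negative function over the rank-`4` supersets of `B` dominates its sum over `B ∪ Z`, `Z` in a
family of sets disjoint from `B` with `B ∪ Z` of rank `4`. -/
theorem sum_levelSet_ge_sum_family {B : Finset α} (f : Finset α → ℚ) (hf : ∀ S, 0 ≤ f S)
    (fam : Finset (Finset α)) (hfam : ∀ Z ∈ fam, Disjoint B Z ∧ B ∪ Z ∈ Shadow.levelSet M 4) :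
    ∑ Z ∈ fam, f (B ∪ Z) ≤ ∑ S ∈ (Shadow.levelSet M 4).filter (fun S => B ⊆ S), f S := by
  have hinj : Set.InjOn (fun Z => B ∪ Z) (fam : Set (Finset α)) := by
    intro Z hZ Z' hZ' h
    have h1 := union_sdiff_self_eq (hfam Z hZ).1
    have h2 := union_sdiff_self_eq (hfam Z' hZ').1
    simp only at h
    rw [← h1, ← h2, h]
  rw [← Finset.sum_image hinj]
  apply Finset.sum_le_sum_of_subset_of_nonneg
  · intro S hS
    rw [Finset.mem_image] at hS
    obtain ⟨Z, hZ, rfl⟩ := hS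
    exact Finset.mem_filter.2 ⟨(hfam Z hZ).2, Finset.subset_union_left⟩
  · intro S _ _
    exact hf S

end FourRuleE
end PercRepro
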